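import Literature.MathematicalPhysics.QuantumLattice.HubbardSpinChargeCertificate
import Literature.MathematicalPhysics.QuantumLattice.HubbardWindowCertificate
import Literature.MathematicalPhysics.QuantumLattice.HubbardSzSectorLadder
import Literature.MathematicalPhysics.QuantumLattice.FreeFermiGasNoPairFieldLRO
import Literature.MathematicalPhysics.QuantumLattice.SectorGroundProjContinuity
import HarnessLib

/-!
# The second-quantized molecular electronic Hamiltonian (orbital basis)

Topic `MathematicalPhysics/QuantumChemistry`. The nonrelativistic, spin-free, Born–Oppenheimer
electronic Hamiltonian of a molecule (or of an active-space model of one) in a finite basis of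
spatial orbitals `Λ`, written in second quantization over the `2|Λ|` spin orbitals
`Orb Λ = Λ ×ₗ Fin 2` (spin `0 = α = ↑`, `1 = β = ↓`) with the tree's Jordan–Wigner matrices
`creation` / `annihilation` on the fermionic Fock space `Fock (Orb Λ) = Finset (Orb Λ) → ℂ`
(`Literature.MathematicalPhysics.QuantumLattice.FermionOperators`, `HubbardWave0`):

`Ĥ = Σ_pq h_pq E_pq + ½ Σ_pqrs g_pqrs e_pqrs + h_nuc`  (Helgaker–Jørgensen–Olsen (2.2.18)),

with the singlet excitation operators `E_pq = Σ_σ a†_{pσ} a_{qσ}` (HJO (2.2.7)), the two-electron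
excitation operators `e_pqrs = Σ_{στ} a†_{pσ} a†_{rτ} a_{sτ} a_{qσ} = E_pq E_rs − δ_qr E_ps`
(HJO (2.2.16)), one-electron integrals `h_pq` (2.2.19), two-electron integrals `g_pqrs = (pq|rs)`
in Mulliken ("chemists'") notation (2.2.20), and the scalar nuclear-repulsion / core constant
`h_nuc` (1.4.42). This is also the operator encoded by an FCIDUMP integral file
(`E_core + Σ_{pq,σ} h_pq a†_{pσ}a_{qσ} + ½ Σ_{pqrs,στ} (pq|rs) a†_{pσ}a†_{rτ}a_{sτ}a_{qσ}`).

## Contents (all PROVED; no named fact)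
* `singletExcitation p q`, `twoElectronExcitation p q r s`, `molecularHamiltonian h g hnuc`
  (coefficients in `ℂ`; real/rational integral tables are used through the casts);
* adjoints: `(E_pq)ᴴ = E_qp`, `(e_pqrs)ᴴ = e_qpsr`; Hermiticity of `Ĥ` under the Hermitian integral
  symmetries `h_pq = h_qp*`, `g_pqrs = g_qpsr*` (HJO (2.2.5), (2.2.13); for real orbitals these are
  among the eight permutational symmetries (2.2.12), (2.2.14));
* conservation laws: `E_pq`, `e_pqrs` and `Ĥ` commute with the particle number `N̂` and with `Ŝ_z`
  (singlet operators, HJO §2.3.4), hence `Ĥ` maps every joint sector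
  `szSector N M = {N̂ = N, Ŝ_z = M}` into itself;
* `sectorGroundEnergy H a b`: the lowest energy of `H` in the sector with `a` spin-up and `b`
  spin-down electrons, `minEnergyOn H (szSector (a + b) ((a − b)/2))`; the sector is non-trivial for
  `a, b ≤ |Λ|` (`szSector_upDown_ne_bot`) and, for `Ĥ`, the sector energy is attained at an
  eigenvector (`exists_unit_eigen_sectorGroundEnergy`).

What is NOT here: spin–orbit / external-field terms (HJO §2.2.3), the spin-adapted (CSF) basis,
the `Ŝ_±`-invariance of `Ĥ` and the resulting `N`-sector / multiplet statements, and anything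
about particular molecules or integral files (those are model data, not literature).

## References
* T. Helgaker, P. Jørgensen, J. Olsen, *Molecular Electronic-Structure Theory*, Wiley (2000),
  §1.4.3 eq. (1.4.39)–(1.4.42), §2.2.1 eqs. (2.2.5)–(2.2.7), (2.2.12)–(2.2.20), §2.2.2 (2.2.30),
  §2.3.4 (singlet operators commute with `Ŝ_±`, `Ŝ_z`). [cite: HelgakerJorgensenOlsen2000, eq. (2.2.18)]
* E. H. Lieb, *Two theorems on the Hubbard model*, PRL 62 (1989) 1201 (work in a sector of fixed
  `N↑`, `N↓`). [cite: LiebPRL1989, proof of Theorem 1]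
* H. Tasaki, *Physics and Mathematics of Quantum Many-Body Systems* (2020), §2.2 (variational
  characterisation of the lowest energy in an invariant subspace). [cite: Tasaki2020, §2.2]
-/

noncomputable section

namespace Literature.MathematicalPhysics.QuantumChemistry

open Matrix Finset
open Literature.MathematicalPhysics.QuantumLattice
open scoped ComplexOrder BigOperators

variable {Λ : Type*} [LinearOrder Λ] [Fintype Λ]

/-! ### Excitation operators and the Hamiltonian -/

/-- The **singlet excitation operator** `E_pq = a†_{p↑} a_{q↑} + a†_{p↓} a_{q↓}` of the orbital pair
`(p, q)`. Helgaker–Jørgensen–Olsen (2000) eq. (2.2.7). [cite: HelgakerJorgensenOlsen2000, eq. (2.2.7)] -/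
def singletExcitation (p q : Λ) : Matrix (Finset (Orb Λ)) (Finset (Orb Λ)) ℂ :=
  ∑ σ : Fin 2, creation (orb p σ) * annihilation (orb q σ)

/-- The **two-electron excitation operator** `e_pqrs = Σ_{στ} a†_{pσ} a†_{rτ} a_{sτ} a_{qσ}`
(`= E_pq E_rs − δ_qr E_ps`). Helgaker–Jørgensen–Olsen (2000) eq. (2.2.16).
[cite: HelgakerJorgensenOlsen2000, eq. (2.2.16)] -/
def twoElectronExcitation (p q r s : Λ) : Matrix (Finset (Orb Λ)) (Finset (Orb Λ)) ℂ :=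
  ∑ σ : Fin 2, ∑ τ : Fin 2,
    creation (orb p σ) * creation (orb r τ) * annihilation (orb s τ) * annihilation (orb q σ)

/-- The **second-quantized nonrelativistic, spin-free molecular electronic Hamiltonian in the
orbital basis** `Λ`:
`Ĥ = Σ_pq h_pq E_pq + ½ Σ_pqrs g_pqrs e_pqrs + h_nuc · 1`,
with one-electron integrals `h_pq`, two-electron integrals `g_pqrs = (pq|rs)` (Mulliken / chemists'
notation: `p, q` refer to electron 1, `r, s` to electron 2) and the scalar constant `h_nuc`
(nuclear repulsion, plus any frozen-core energy of an active-space model). Written out,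
`Ĥ = h_nuc + Σ_{pq,σ} h_pq a†_{pσ} a_{qσ} + ½ Σ_{pqrs,στ} (pq|rs) a†_{pσ} a†_{rτ} a_{sτ} a_{qσ}` — the
operator defined by an FCIDUMP integral file. The coefficients are taken in `ℂ` (complex orbitals
allowed); real or exact-rational integral tables enter through the casts, and `Ĥ` is Hermitian under
the integral symmetries of `molecularHamiltonian_isHermitian`. Helgaker–Jørgensen–Olsen (2000)
eq. (2.2.18) (spin-orbital form (1.4.39)). [cite: HelgakerJorgensenOlsen2000, eq. (2.2.18)] -/
def molecularHamiltonian (h : Λ → Λ → ℂ) (g : Λ → Λ → Λ → Λ → ℂ) (hnuc : ℂ) :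
    Matrix (Finset (Orb Λ)) (Finset (Orb Λ)) ℂ :=
  ∑ p : Λ, ∑ q : Λ, h p q • singletExcitation p q +
    (1 / 2 : ℂ) • ∑ p : Λ, ∑ q : Λ, ∑ r : Λ, ∑ s : Λ, g p q r s • twoElectronExcitation p q r s +
    hnuc • (1 : Matrix (Finset (Orb Λ)) (Finset (Orb Λ)) ℂ)

/-- Unfolding `molecularHamiltonian` into creation / annihilation matrices:
`Ĥ = Σ_{pq} h_pq Σ_σ a†_{pσ}a_{qσ} + ½ Σ_{pqrs} g_pqrs Σ_{στ} a†_{pσ}a†_{rτ}a_{sτ}a_{qσ} + h_nuc·1`.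
Helgaker–Jørgensen–Olsen (2000) eqs. (2.2.15), (2.2.18). [cite: HelgakerJorgensenOlsen2000, eq. (2.2.18)] -/
theorem molecularHamiltonian_eq (h : Λ → Λ → ℂ) (g : Λ → Λ → Λ → Λ → ℂ) (hnuc : ℂ) :
    molecularHamiltonian h g hnuc =
      ∑ p : Λ, ∑ q : Λ, h p q • ∑ σ : Fin 2, creation (orb p σ) * annihilation (orb q σ) +
        (1 / 2 : ℂ) • ∑ p : Λ, ∑ q : Λ, ∑ r : Λ, ∑ s : Λ, g p q r s • ∑ σ : Fin 2, ∑ τ : Fin 2,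
          creation (orb p σ) * creation (orb r τ) * annihilation (orb s τ) * annihilation (orb q σ) +
        hnuc • (1 : Matrix (Finset (Orb Λ)) (Finset (Orb Λ)) ℂ) :=
  rfl

/-! ### Adjoints and Hermiticity -/

/-- `E_pq† = E_qp`. Helgaker–Jørgensen–Olsen (2000) §2.3.4 (the singlet excitation operator is
mapped to `E_qp` by conjugation). [cite: HelgakerJorgensenOlsen2000, §2.3.4] -/
theorem conjTranspose_singletExcitation (p q : Λ) :
    (singletExcitation p q)ᴴ = singletExcitation q p := by
  simp only [singletExcitation, conjTranspose_sum, conjTranspose_mul, creation_conjTranspose,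
    annihilation_conjTranspose]

/-- `e_pqrs† = e_qpsr` (reverse the operator string and exchange creators with annihilators).
Helgaker–Jørgensen–Olsen (2000) eqs. (2.2.13), (2.2.16). [cite: HelgakerJorgensenOlsen2000, eq. (2.2.16)] -/
theorem conjTranspose_twoElectronExcitation (p q r s : Λ) :
    (twoElectronExcitation p q r s)ᴴ = twoElectronExcitation q p s r := by
  simp only [twoElectronExcitation, conjTranspose_sum, conjTranspose_mul, creation_conjTranspose,
    annihilation_conjTranspose, Matrix.mul_assoc]

/-- **Hermiticity.** If the integrals have the Hermitian permutational symmetries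
`h_pq = (h_qp)*` and `g_pqrs = (g_qpsr)*` (Helgaker–Jørgensen–Olsen (2.2.5), (2.2.13); automatic
for real orbitals, (2.2.14)) and `h_nuc` is real, then `Ĥ` is Hermitian.
[cite: HelgakerJorgensenOlsen2000, eq. (2.2.13)] -/
theorem molecularHamiltonian_isHermitian {h : Λ → Λ → ℂ} {g : Λ → Λ → Λ → Λ → ℂ} {hnuc : ℂ}
    (hh : ∀ p q, star (h p q) = h q p) (hg : ∀ p q r s, star (g p q r s) = g q p s r)
    (hn : star hnuc = hnuc) : (molecularHamiltonian h g hnuc).IsHermitian := by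
  have h1 : (∑ p : Λ, ∑ q : Λ, h p q • singletExcitation p q)ᴴ =
      ∑ p : Λ, ∑ q : Λ, h p q • singletExcitation p q := by
    simp only [conjTranspose_sum, conjTranspose_smul, conjTranspose_singletExcitation, hh]
    rw [Finset.sum_comm]
  have h2 : (∑ p : Λ, ∑ q : Λ, ∑ r : Λ, ∑ s : Λ, g p q r s • twoElectronExcitation p q r s)ᴴ =
      ∑ p : Λ, ∑ q : Λ, ∑ r : Λ, ∑ s : Λ, g p q r s • twoElectronExcitation p q r s := by
    simp only [conjTranspose_sum, conjTranspose_smul, conjTranspose_twoElectronExcitation, hg]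
    rw [Finset.sum_comm]
    refine Finset.sum_congr rfl fun q _ => Finset.sum_congr rfl fun p _ => ?_
    rw [Finset.sum_comm]
  have h12 : star ((1 : ℂ) / 2) = 1 / 2 := by
    rw [Complex.star_def, map_div₀, map_one, map_ofNat]
  unfold molecularHamiltonian
  rw [IsHermitian, conjTranspose_add, conjTranspose_add, conjTranspose_smul, conjTranspose_smul,
    conjTranspose_one, h1, h2, h12, hn]

/-- Hermiticity for REAL integral tables (the FCIDUMP case): `h` symmetric and `g_pqrs = g_qpsr`
(one of the eight permutational symmetries of real two-electron integrals, Helgaker–Jørgensen–Olsen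
(2.2.12), (2.2.14)), real `h_nuc`. [cite: HelgakerJorgensenOlsen2000, eq. (2.2.14)] -/
theorem molecularHamiltonian_isHermitian_of_real {h : Λ → Λ → ℝ} {g : Λ → Λ → Λ → Λ → ℝ}
    (hnuc : ℝ) (hh : ∀ p q, h p q = h q p) (hg : ∀ p q r s, g p q r s = g q p s r) :
    (molecularHamiltonian (fun p q => (h p q : ℂ)) (fun p q r s => (g p q r s : ℂ))
      (hnuc : ℂ)).IsHermitian :=
  molecularHamiltonian_isHermitian (fun p q => by rw [Complex.star_def, Complex.conj_ofReal, hh])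
    (fun p q r s => by rw [Complex.star_def, Complex.conj_ofReal, hg])
    (by rw [Complex.star_def, Complex.conj_ofReal])

/-! ### Conservation of `N̂` and `Ŝ_z` -/

/-- `a†_{pσ} a_{qσ'}` as a ladder word (private bookkeeping for the charge calculus). [folklore] -/
private theorem creation_mul_annihilation_eq_ladderWord (i j : Orb Λ) :
    creation i * annihilation j = ladderWord [(i, true), (j, false)] := by
  simp [ladderWord, ladderLetter]

/-- `a†_i a†_j a_k a_l` as a ladder word (private bookkeeping). [folklore] -/
private theorem creation_creation_annihilation_annihilation_eq_ladderWord (i j k l : Orb Λ) :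
    creation i * creation j * annihilation k * annihilation l =
      ladderWord [(i, true), (j, true), (k, false), (l, false)] := by
  simp [ladderWord, ladderLetter, Matrix.mul_assoc]

/-- A ladder word of zero particle charge commutes with `N̂` (`[N̂, w] = q(w) · w`,
`totalNumber_comm_ladderWord`; private helper). [folklore] -/
private theorem commute_ladderWord_totalNumber {l : List (Orb Λ × Bool)} (hl : ladderCharge l = 0) :
    Commute (ladderWord l) (totalNumber : Matrix (Finset (Orb Λ)) (Finset (Orb Λ)) ℂ) := by
  have h := totalNumber_comm_ladderWord l
  rw [hl, Int.cast_zero, zero_smul, sub_eq_zero] at h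
  exact h.symm

/-- A ladder word of zero spin charge commutes with `Ŝ_z` (`[Ŝ_z, w] = (q_s(w)/2) · w`,
`spinZ_comm_ladderWord`; private helper). [folklore] -/
private theorem commute_ladderWord_spinZ {l : List (Orb Λ × Bool)} (hl : ladderSpinCharge l = 0) :
    Commute (ladderWord l) (HubbardWave0.spinZ : Matrix (Finset (Orb Λ)) (Finset (Orb Λ)) ℂ) := by
  have h := spinZ_comm_ladderWord l
  rw [hl, Int.cast_zero, zero_div, zero_smul, sub_eq_zero] at h
  exact h.symm

/-- `E_pq` conserves the particle number: `[E_pq, N̂] = 0`. Helgaker–Jørgensen–Olsen (2000) §2.3.5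
(the `E_pq` generate the number-conserving unitary group). [cite: HelgakerJorgensenOlsen2000, §2.3.5] -/
theorem singletExcitation_commute_totalNumber (p q : Λ) :
    Commute (singletExcitation p q) (totalNumber : Matrix (Finset (Orb Λ)) (Finset (Orb Λ)) ℂ) := by
  refine Commute.sum_left _ _ _ fun σ _ => ?_
  rw [creation_mul_annihilation_eq_ladderWord]
  exact commute_ladderWord_totalNumber (by simp)

/-- `E_pq` is a singlet operator: `[E_pq, Ŝ_z] = 0`. Helgaker–Jørgensen–Olsen (2000) §2.3.4.
[cite: HelgakerJorgensenOlsen2000, §2.3.4] -/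
theorem singletExcitation_commute_spinZ (p q : Λ) :
    Commute (singletExcitation p q) (HubbardWave0.spinZ : Matrix (Finset (Orb Λ)) (Finset (Orb Λ)) ℂ) := by
  refine Commute.sum_left _ _ _ fun σ _ => ?_
  rw [creation_mul_annihilation_eq_ladderWord]
  refine commute_ladderWord_spinZ ?_
  simp only [ladderSpinCharge_cons, ladderSpinCharge_nil, letterSpinCharge, orb, ofLex_toLex,
    if_true, Bool.false_eq_true, if_false]
  ring

/-- `e_pqrs` conserves the particle number: `[e_pqrs, N̂] = 0`. Helgaker–Jørgensen–Olsen (2000) §2.3.5.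
[cite: HelgakerJorgensenOlsen2000, §2.3.5] -/
theorem twoElectronExcitation_commute_totalNumber (p q r s : Λ) :
    Commute (twoElectronExcitation p q r s)
      (totalNumber : Matrix (Finset (Orb Λ)) (Finset (Orb Λ)) ℂ) := by
  refine Commute.sum_left _ _ _ fun σ _ => Commute.sum_left _ _ _ fun τ _ => ?_
  rw [creation_creation_annihilation_annihilation_eq_ladderWord]
  exact commute_ladderWord_totalNumber (by simp)

/-- `e_pqrs` is a singlet operator: `[e_pqrs, Ŝ_z] = 0`. Helgaker–Jørgensen–Olsen (2000) §2.3.4.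
[cite: HelgakerJorgensenOlsen2000, §2.3.4] -/
theorem twoElectronExcitation_commute_spinZ (p q r s : Λ) :
    Commute (twoElectronExcitation p q r s)
      (HubbardWave0.spinZ : Matrix (Finset (Orb Λ)) (Finset (Orb Λ)) ℂ) := by
  refine Commute.sum_left _ _ _ fun σ _ => Commute.sum_left _ _ _ fun τ _ => ?_
  rw [creation_creation_annihilation_annihilation_eq_ladderWord]
  refine commute_ladderWord_spinZ ?_
  simp only [ladderSpinCharge_cons, ladderSpinCharge_nil, letterSpinCharge, orb, ofLex_toLex,
    if_true, Bool.false_eq_true, if_false]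
  ring

/-- **`Ĥ` conserves the particle number**: `[Ĥ, N̂] = 0`. Helgaker–Jørgensen–Olsen (2000)
§2.3.4–§2.3.5 (`Ĥ` is built from singlet excitation operators, (2.3.30)).
[cite: HelgakerJorgensenOlsen2000, §2.3.4] -/
theorem molecularHamiltonian_commute_totalNumber (h : Λ → Λ → ℂ) (g : Λ → Λ → Λ → Λ → ℂ)
    (hnuc : ℂ) :
    Commute (molecularHamiltonian h g hnuc)
      (totalNumber : Matrix (Finset (Orb Λ)) (Finset (Orb Λ)) ℂ) := by
  unfold molecularHamiltonian
  refine Commute.add_left (Commute.add_left ?_ ?_) ((Commute.one_left _).smul_left _)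
  · exact Commute.sum_left _ _ _ fun p _ => Commute.sum_left _ _ _ fun q _ =>
      (singletExcitation_commute_totalNumber p q).smul_left _
  · refine Commute.smul_left ?_ _
    exact Commute.sum_left _ _ _ fun p _ => Commute.sum_left _ _ _ fun q _ =>
      Commute.sum_left _ _ _ fun r _ => Commute.sum_left _ _ _ fun s _ =>
        (twoElectronExcitation_commute_totalNumber p q r s).smul_left _

/-- **`Ĥ` conserves `Ŝ_z`**: `[Ĥ, Ŝ_z] = 0` (a singlet operator commutes with the spin-projection
operator). Helgaker–Jørgensen–Olsen (2000) §2.3.4. [cite: HelgakerJorgensenOlsen2000, §2.3.4] -/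
theorem molecularHamiltonian_commute_spinZ (h : Λ → Λ → ℂ) (g : Λ → Λ → Λ → Λ → ℂ) (hnuc : ℂ) :
    Commute (molecularHamiltonian h g hnuc)
      (HubbardWave0.spinZ : Matrix (Finset (Orb Λ)) (Finset (Orb Λ)) ℂ) := by
  unfold molecularHamiltonian
  refine Commute.add_left (Commute.add_left ?_ ?_) ((Commute.one_left _).smul_left _)
  · exact Commute.sum_left _ _ _ fun p _ => Commute.sum_left _ _ _ fun q _ =>
      (singletExcitation_commute_spinZ p q).smul_left _
  · refine Commute.smul_left ?_ _
    exact Commute.sum_left _ _ _ fun p _ => Commute.sum_left _ _ _ fun q _ =>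
      Commute.sum_left _ _ _ fun r _ => Commute.sum_left _ _ _ fun s _ =>
        (twoElectronExcitation_commute_spinZ p q r s).smul_left _

/-- `Ĥ` maps every joint sector `(N̂ = N, Ŝ_z = M)` into itself. Helgaker–Jørgensen–Olsen (2000)
§2.3.4; Lieb, PRL 62 (1989) 1201 (work in a fixed `(N↑, N↓)` sector). [cite: HelgakerJorgensenOlsen2000, §2.3.4] -/
theorem molecularHamiltonian_mulVec_mem_szSector (h : Λ → Λ → ℂ) (g : Λ → Λ → Λ → Λ → ℂ)
    (hnuc : ℂ) {N : ℕ} {M : ℝ} {ψ : Fock (Orb Λ)} (hψ : ψ ∈ szSector N M) :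
    molecularHamiltonian h g hnuc *ᵥ ψ ∈ szSector N M :=
  mulVec_mem_szSector_of_commute (molecularHamiltonian_commute_totalNumber h g hnuc)
    (molecularHamiltonian_commute_spinZ h g hnuc) hψ

/-! ### The `(N↑, N↓)`-sector ground-state energy -/

/-- The **`(N↑, N↓) = (a, b)` sector ground-state energy** of an operator `H` on the spinful Fock
space: the lowest energy `minEnergyOn H K` of `H` in the joint sector
`K = szSector (a + b) ((a − b)/2)` (`N̂ = a + b`, `Ŝ_z = (a − b)/2`; equivalently the span of the
occupation-basis vectors with `a` up and `b` down electrons, `mem_szSector_iff_isInSector`). For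
Hermitian `H` preserving the sector this is the lowest eigenvalue of `H` restricted to it; junk value
`0` when the sector is trivial (`a > |Λ|` or `b > |Λ|`). Lieb, PRL 62 (1989) 1201, proof of Thm 1
("work in a sector of fixed numbers of up and down electrons"); Tasaki (2020) §2.2.
[cite: LiebPRL1989, proof of Theorem 1] -/
def sectorGroundEnergy (H : Matrix (Finset (Orb Λ)) (Finset (Orb Λ)) ℂ) (a b : ℕ) : ℝ :=
  H.minEnergyOn (szSector (a + b) (((a : ℝ) - b) / 2))

/-- Unfolding lemma for `sectorGroundEnergy` (the definition restated: lowest energy in the sector of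
fixed `N↑ = a`, `N↓ = b`). Lieb, PRL 62 (1989) 1201, proof of Theorem 1. [cite: LiebPRL1989, proof of Theorem 1] -/
theorem sectorGroundEnergy_def (H : Matrix (Finset (Orb Λ)) (Finset (Orb Λ)) ℂ) (a b : ℕ) :
    sectorGroundEnergy H a b = H.minEnergyOn (szSector (a + b) (((a : ℝ) - b) / 2)) :=
  rfl

/-- The occupation-basis vector `|α↑ ∪ β↓⟩` lies in the sector `(#α, #β)`. Lieb, PRL 62 (1989) 1201,
proof of Theorem 1. [cite: LiebPRL1989, proof of Theorem 1] -/
theorem isInSector_single_pairSet (α β : Finset Λ) :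
    IsInSector α.card β.card (Pi.single (pairSet α β) (1 : ℂ) : Fock (Orb Λ)) := by
  intro s hs
  rw [Pi.single_apply, if_neg]
  rintro rfl
  exact hs ⟨by rw [upPart_pairSet], by rw [downPart_pairSet]⟩

/-- **The `(a, b)` sector is non-trivial for `a, b ≤ |Λ|`** (it contains `|α↑ ∪ β↓⟩` for any
`α`, `β` of those sizes). Lieb, PRL 62 (1989) 1201, proof of Theorem 1. [cite: LiebPRL1989, proof of Theorem 1] -/
theorem szSector_upDown_ne_bot {a b : ℕ} (ha : a ≤ Fintype.card Λ) (hb : b ≤ Fintype.card Λ) :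
    (szSector (a + b) (((a : ℝ) - b) / 2) : Submodule ℂ (Fock (Orb Λ))) ≠ ⊥ := by
  classical
  obtain ⟨α, -, hα⟩ : ∃ α : Finset Λ, α ⊆ univ ∧ α.card = a :=
    Finset.exists_subset_card_eq (by rwa [Finset.card_univ])
  obtain ⟨β, -, hβ⟩ : ∃ β : Finset Λ, β ⊆ univ ∧ β.card = b :=
    Finset.exists_subset_card_eq (by rwa [Finset.card_univ])
  rw [Submodule.ne_bot_iff]
  refine ⟨Pi.single (pairSet α β) 1, ?_, ?_⟩
  · rw [mem_szSector_iff_isInSector, ← hα, ← hβ]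
    exact isInSector_single_pairSet α β
  · intro h0
    have h := congrFun h0 (pairSet α β)
    simp at h

/-- **Variational principle in the `(a, b)` sector.** For Hermitian `H` and any vector `ψ` supported
on the `(a, b)` sector, `sectorGroundEnergy H a b · ⟨ψ, ψ⟩ ≤ Re ⟨ψ, H ψ⟩` (no normalisation, no
eigenvector property needed). Tasaki (2020) §2.2 (min–max / Rayleigh–Ritz in an invariant subspace).
[cite: Tasaki2020, §2.2] -/
theorem sectorGroundEnergy_mul_le_re_rayleigh {H : Matrix (Finset (Orb Λ)) (Finset (Orb Λ)) ℂ}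
    (hH : H.IsHermitian) {a b : ℕ} {ψ : Fock (Orb Λ)} (hψ : IsInSector a b ψ) :
    sectorGroundEnergy H a b * (star ψ ⬝ᵥ ψ).re ≤ (star ψ ⬝ᵥ H *ᵥ ψ).re :=
  minEnergyOn_mul_le_re_rayleigh hH _ ((mem_szSector_iff_isInSector a b ψ).2 hψ)

/-- **Rayleigh–Ritz upper bound in the `(a, b)` sector.** For Hermitian `H`, a NONZERO vector `ψ`
supported on the `(a, b)` sector and a number `u` with `Re ⟨ψ, Hψ⟩ ≤ u · ⟨ψ, ψ⟩` (exact Rayleigh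
data of an explicit trial state — a CI vector, an MPS), `sectorGroundEnergy H a b ≤ u`.
Tasaki (2020) §2.2; Helgaker–Jørgensen–Olsen (2000) §4.2.1 (the variation principle).
[cite: Tasaki2020, §2.2] -/
theorem sectorGroundEnergy_le_of_rayleigh {H : Matrix (Finset (Orb Λ)) (Finset (Orb Λ)) ℂ}
    (hH : H.IsHermitian) {a b : ℕ} {ψ : Fock (Orb Λ)} (hψ : IsInSector a b ψ) (h0 : ψ ≠ 0)
    {u : ℝ} (hu : (star ψ ⬝ᵥ H *ᵥ ψ).re ≤ u * (star ψ ⬝ᵥ ψ).re) :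
    sectorGroundEnergy H a b ≤ u := by
  have hpos : 0 < (star ψ ⬝ᵥ ψ).re := by
    have h1 : 0 < star ψ ⬝ᵥ ψ :=
      lt_of_le_of_ne (dotProduct_star_self_nonneg ψ) (Ne.symm (mt dotProduct_star_self_eq_zero.1 h0))
    exact (Complex.pos_iff.1 h1).1
  exact le_of_mul_le_mul_right ((sectorGroundEnergy_mul_le_re_rayleigh hH hψ).trans hu) hpos

/-- **The sector energy of `Ĥ` is attained.** For Hermitian integral data and `a, b ≤ |Λ|` there is a
unit vector `ψ` of the `(a, b)` sector with `Ĥ ψ = sectorGroundEnergy Ĥ a b · ψ` (finite dimension;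
`Ĥ` preserves the sector). Tasaki (2020) §2.2. [cite: Tasaki2020, §2.2] -/
theorem exists_unit_eigen_sectorGroundEnergy {h : Λ → Λ → ℂ} {g : Λ → Λ → Λ → Λ → ℂ} {hnuc : ℂ}
    (hH : (molecularHamiltonian h g hnuc).IsHermitian) {a b : ℕ} (ha : a ≤ Fintype.card Λ)
    (hb : b ≤ Fintype.card Λ) :
    ∃ ψ : Fock (Orb Λ), IsInSector a b ψ ∧ star ψ ⬝ᵥ ψ = 1 ∧
      molecularHamiltonian h g hnuc *ᵥ ψ =
        ((sectorGroundEnergy (molecularHamiltonian h g hnuc) a b : ℝ) : ℂ) • ψ := by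
  obtain ⟨ψ, hψK, hψ1, hHψ⟩ := exists_unit_eigen_minEnergyOn hH
    (szSector (a + b) (((a : ℝ) - b) / 2))
    (fun v hv => molecularHamiltonian_mulVec_mem_szSector h g hnuc hv) (szSector_upDown_ne_bot ha hb)
  exact ⟨ψ, (mem_szSector_iff_isInSector a b ψ).1 hψK, hψ1, hHψ⟩

/-! ### Spin-rotation invariance: `Ĥ` commutes with `Ŝ_±` and `Ŝ²` (appended 2026-08-21, typer T-05)

Helgaker–Jørgensen–Olsen §2.3.4: every singlet operator — in particular `E_pq`, `e_pqrs` and the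
spin-free Hamiltonian (2.3.30) — commutes with the shift operators `Ŝ_±` and with `Ŝ_z`, hence with
`Ŝ²`. The tree already proves `[Σ_σ a†_{xσ} a_{yσ}, Ŝ_+] = 0` (`LiebThm1.sum_hopping_commute_spinPlus`,
the Hubbard hopping term IS `E_xy`); the two-electron operator is reduced to it by the product rule
`E_pq E_rs = e_pqrs + δ_qr E_ps` (HJO (2.2.16)), proved here from the CAR. -/

/-- **Product of singlet excitation operators** (Helgaker–Jørgensen–Olsen (2.2.16) rearranged):
`E_pq E_rs = e_pqrs + δ_qr E_ps`, from `a_{qσ} a†_{rτ} = δ_{qr}δ_{στ} − a†_{rτ} a_{qσ}` and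
`a_{qσ} a_{sτ} = −a_{sτ} a_{qσ}`. [cite: HelgakerJorgensenOlsen2000, eq. (2.2.16)] -/
theorem singletExcitation_mul_singletExcitation (p q r s : Λ) :
    singletExcitation p q * singletExcitation r s =
      twoElectronExcitation p q r s + if q = r then singletExcitation p s else 0 := by
  have hCAR := annihilation_mul_creation_add_creation_mul_annihilation_holds (ι := Orb Λ)
  have hCC := annihilation_anticommute_holds (ι := Orb Λ)
  have key : ∀ σ τ : Fin 2,
      creation (orb p σ) * annihilation (orb q σ) * (creation (orb r τ) * annihilation (orb s τ)) =
        creation (orb p σ) * creation (orb r τ) * annihilation (orb s τ) * annihilation (orb q σ) +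
          if orb q σ = orb r τ then creation (orb p σ) * annihilation (orb s τ) else 0 := by
    intro σ τ
    have h1 : annihilation (orb q σ) * creation (orb r τ) =
        (if orb q σ = orb r τ then (1 : Matrix (Finset (Orb Λ)) (Finset (Orb Λ)) ℂ) else 0) -
          creation (orb r τ) * annihilation (orb q σ) :=
      eq_sub_of_add_eq (hCAR (orb q σ) (orb r τ))
    have h2 : annihilation (orb q σ) * annihilation (orb s τ) =
        -(annihilation (orb s τ) * annihilation (orb q σ)) :=
      eq_neg_of_add_eq_zero_left (hCC (orb q σ) (orb s τ))
    calc creation (orb p σ) * annihilation (orb q σ) * (creation (orb r τ) * annihilation (orb s τ))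
        = creation (orb p σ) * (annihilation (orb q σ) * creation (orb r τ)) * annihilation (orb s τ) := by
          simp only [Matrix.mul_assoc]
      _ = creation (orb p σ) * ((if orb q σ = orb r τ then (1 : Matrix (Finset (Orb Λ)) (Finset (Orb Λ)) ℂ)
            else 0) - creation (orb r τ) * annihilation (orb q σ)) * annihilation (orb s τ) := by rw [h1]
      _ = (if orb q σ = orb r τ then creation (orb p σ) * annihilation (orb s τ) else 0) -
            creation (orb p σ) * creation (orb r τ) * (annihilation (orb q σ) * annihilation (orb s τ)) := by
          split_ifs
          · simp only [Matrix.mul_sub, Matrix.sub_mul, Matrix.mul_one, Matrix.mul_assoc]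
          · simp only [zero_sub, Matrix.neg_mul, Matrix.mul_neg, Matrix.mul_assoc]
      _ = creation (orb p σ) * creation (orb r τ) * annihilation (orb s τ) * annihilation (orb q σ) +
            if orb q σ = orb r τ then creation (orb p σ) * annihilation (orb s τ) else 0 := by
          rw [h2, Matrix.mul_neg, sub_neg_eq_add, add_comm, Matrix.mul_assoc, Matrix.mul_assoc,
            Matrix.mul_assoc]
  have hδ : ∀ σ : Fin 2, (∑ τ : Fin 2, if orb q σ = orb r τ then
      creation (orb p σ) * annihilation (orb s τ) else (0 : Matrix (Finset (Orb Λ)) (Finset (Orb Λ)) ℂ)) =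
      if q = r then creation (orb p σ) * annihilation (orb s σ) else 0 := by
    intro σ
    by_cases hqr : q = r
    · subst hqr
      simp only [if_true]
      rw [Finset.sum_eq_single σ (fun τ _ hτ => if_neg fun h => hτ ((orb_inj.1 h).2).symm)
        (fun h => absurd (Finset.mem_univ σ) h), if_pos rfl]
    · rw [if_neg hqr]
      exact Finset.sum_eq_zero fun τ _ => if_neg fun h => hqr (orb_inj.1 h).1
  unfold singletExcitation twoElectronExcitation
  rw [Finset.sum_mul_sum]
  simp_rw [key, Finset.sum_add_distrib, hδ]
  congr 1
  split_ifs with hqr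
  · rfl
  · simp

/-- **`e_pqrs = E_pq E_rs − δ_qr E_ps`** — Helgaker–Jørgensen–Olsen (2000) eq. (2.2.16).
[cite: HelgakerJorgensenOlsen2000, eq. (2.2.16)] -/
theorem twoElectronExcitation_eq_mul_sub (p q r s : Λ) :
    twoElectronExcitation p q r s =
      singletExcitation p q * singletExcitation r s - if q = r then singletExcitation p s else 0 := by
  rw [singletExcitation_mul_singletExcitation, add_sub_cancel_right]

/-- `E_pq` is a singlet operator: `[E_pq, Ŝ_+] = 0` (the tree's `LiebThm1.sum_hopping_commute_spinPlus`).
Helgaker–Jørgensen–Olsen (2000) §2.3.4. [cite: HelgakerJorgensenOlsen2000, §2.3.4] -/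
theorem singletExcitation_commute_spinPlus (p q : Λ) :
    Commute (singletExcitation p q) (spinPlus : Matrix (Finset (Orb Λ)) (Finset (Orb Λ)) ℂ) :=
  LiebThm1.sum_hopping_commute_spinPlus p q

/-- `[E_pq, Ŝ_−] = 0` (adjoint of `[E_qp, Ŝ_+] = 0`; `Ŝ_− = Ŝ_+†`, HJO (2.2.31)).
[cite: HelgakerJorgensenOlsen2000, §2.3.4] -/
theorem singletExcitation_commute_spinMinus (p q : Λ) :
    Commute (singletExcitation p q) (spinMinus : Matrix (Finset (Orb Λ)) (Finset (Orb Λ)) ℂ) := by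
  have h := (singletExcitation_commute_spinPlus q p).eq
  have h' := congrArg conjTranspose h
  rw [conjTranspose_mul, conjTranspose_mul, conjTranspose_singletExcitation] at h'
  exact h'.symm

/-- `e_pqrs` is a singlet operator: `[e_pqrs, Ŝ_+] = 0`. Helgaker–Jørgensen–Olsen (2000) §2.3.4.
[cite: HelgakerJorgensenOlsen2000, §2.3.4] -/
theorem twoElectronExcitation_commute_spinPlus (p q r s : Λ) :
    Commute (twoElectronExcitation p q r s) (spinPlus : Matrix (Finset (Orb Λ)) (Finset (Orb Λ)) ℂ) := by
  rw [twoElectronExcitation_eq_mul_sub]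
  refine Commute.sub_left ((singletExcitation_commute_spinPlus p q).mul_left
    (singletExcitation_commute_spinPlus r s)) ?_
  split_ifs
  · exact singletExcitation_commute_spinPlus p s
  · exact Commute.zero_left _

/-- `[e_pqrs, Ŝ_−] = 0`. Helgaker–Jørgensen–Olsen (2000) §2.3.4. [cite: HelgakerJorgensenOlsen2000, §2.3.4] -/
theorem twoElectronExcitation_commute_spinMinus (p q r s : Λ) :
    Commute (twoElectronExcitation p q r s) (spinMinus : Matrix (Finset (Orb Λ)) (Finset (Orb Λ)) ℂ) := by
  rw [twoElectronExcitation_eq_mul_sub]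
  refine Commute.sub_left ((singletExcitation_commute_spinMinus p q).mul_left
    (singletExcitation_commute_spinMinus r s)) ?_
  split_ifs
  · exact singletExcitation_commute_spinMinus p s
  · exact Commute.zero_left _

/-- **`[Ĥ, Ŝ_+] = 0`**: the spin-free Hamiltonian is a singlet operator. Helgaker–Jørgensen–Olsen
(2000) §2.3.4, eq. (2.3.30). [cite: HelgakerJorgensenOlsen2000, §2.3.4] -/
theorem molecularHamiltonian_commute_spinPlus (h : Λ → Λ → ℂ) (g : Λ → Λ → Λ → Λ → ℂ) (hnuc : ℂ) :
    Commute (molecularHamiltonian h g hnuc) (spinPlus : Matrix (Finset (Orb Λ)) (Finset (Orb Λ)) ℂ) := by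
  unfold molecularHamiltonian
  refine Commute.add_left (Commute.add_left ?_ ?_) ((Commute.one_left _).smul_left _)
  · exact Commute.sum_left _ _ _ fun p _ => Commute.sum_left _ _ _ fun q _ =>
      (singletExcitation_commute_spinPlus p q).smul_left _
  · refine Commute.smul_left ?_ _
    exact Commute.sum_left _ _ _ fun p _ => Commute.sum_left _ _ _ fun q _ =>
      Commute.sum_left _ _ _ fun r _ => Commute.sum_left _ _ _ fun s _ =>
        (twoElectronExcitation_commute_spinPlus p q r s).smul_left _

/-- **`[Ĥ, Ŝ_−] = 0`**. Helgaker–Jørgensen–Olsen (2000) §2.3.4. [cite: HelgakerJorgensenOlsen2000, §2.3.4] -/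
theorem molecularHamiltonian_commute_spinMinus (h : Λ → Λ → ℂ) (g : Λ → Λ → Λ → Λ → ℂ) (hnuc : ℂ) :
    Commute (molecularHamiltonian h g hnuc) (spinMinus : Matrix (Finset (Orb Λ)) (Finset (Orb Λ)) ℂ) := by
  unfold molecularHamiltonian
  refine Commute.add_left (Commute.add_left ?_ ?_) ((Commute.one_left _).smul_left _)
  · exact Commute.sum_left _ _ _ fun p _ => Commute.sum_left _ _ _ fun q _ =>
      (singletExcitation_commute_spinMinus p q).smul_left _
  · refine Commute.smul_left ?_ _
    exact Commute.sum_left _ _ _ fun p _ => Commute.sum_left _ _ _ fun q _ =>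
      Commute.sum_left _ _ _ fun r _ => Commute.sum_left _ _ _ fun s _ =>
        (twoElectronExcitation_commute_spinMinus p q r s).smul_left _

/-- **`[Ĥ, Ŝ²] = 0`** (`Ŝ² = Ŝ_z² + ½(Ŝ_+Ŝ_− + Ŝ_−Ŝ_+)`, HJO (2.2.38)): the spin-free Hamiltonian
conserves the total spin. Helgaker–Jørgensen–Olsen (2000) §2.3.4. [cite: HelgakerJorgensenOlsen2000, §2.3.4] -/
theorem molecularHamiltonian_commute_spinSq (h : Λ → Λ → ℂ) (g : Λ → Λ → Λ → Λ → ℂ) (hnuc : ℂ) :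
    Commute (molecularHamiltonian h g hnuc) (spinSq : Matrix (Finset (Orb Λ)) (Finset (Orb Λ)) ℂ) := by
  have hz := molecularHamiltonian_commute_spinZ h g hnuc
  have hp := molecularHamiltonian_commute_spinPlus h g hnuc
  have hm := molecularHamiltonian_commute_spinMinus h g hnuc
  unfold spinSq
  exact (hz.mul_right hz).add_right (((hp.mul_right hm).add_right (hm.mul_right hp)).smul_right _)

end Literature.MathematicalPhysics.QuantumChemistry

end
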